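import Summits.ABC.IUTFork.Repair.EvalRescueBeds
import Summits.ABC.IUTFork.Cor312UnitCosetShellCells
import HarnessLib

/-!
# [IUTchIII] Cor. 3.12 — the COSET test model, IV-f: the INTERFACE-LEVEL k2 SCREEN of RESCUE-H on the lineage's beds

Proof-only file (D-0012; no definition, no `Prop` fact, nothing asserted about print) of the abc-iut cell (wave-4 prover
abc-iut-w4-d101, gen 8), RESCUE-H numerics/kernel-eval hand «KS/UnitCoset beds» (abc-iut-rh-lead START-HERE v1 §6, RE-ARM ASK 14:28:05Z:
«rows + the (H5) positive-bed witnesses Barrier24 cites; k1 capacity»). TAKES NO SIDE on [IUTchIII] Cor. 3.12 or on any author; `H` below is an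
ARBITRARY candidate in abc-iut-rp-bar's PR-1 arity (`Repair.Sufficient` / `SufficientH` / `SufficientS` of `Repair/Barrier{,2}` = T-a at the
residual / hull-licence / Statement levels); candidates are hypotheses; instantiated ≠ endorsed.

THE SCREEN (what a kernel-eval cell at my beds decides for an R-H candidate `H⋆`, BY NAME):
* §1 **NEGATIVE BED `UnitCoset.cSetting`** (gen 4, p431430; every premise of record ✓ — typed Thm. 3.11 (i)–(iii), `MultiradialCompat`, `BridgeHyps`,
  `|log(q)| > 0`, `ThetaRegionsAdm` (abc-iut-rp-cx's `EvalRescueBeds.coset_thetaRegionsAdm`), three pins — while Licence ✗ · S_H ✗ · S ✗ · Statement ✗):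
  the LEVEL-H cell is abc-iut-rp-cx's `EvalRescueBeds.not_sufficientH_of_holds_coset` (restated here in the lineage's argument order as
  `not_sufficientH_of_holds_at_cSetting`); NEW here are the LEVEL-S and LEVEL-R cells `not_sufficientS_of_holds_at_cSetting` /
  `not_sufficient_of_holds_at_cSetting` — a candidate that HOLDS at the coset bed is NOT a T-a
  supplier of the (xi-f) licence (resp. the Statement, resp. S) over the typed interface: its k2 glue `H⋆ → S_H` must consume structure beyond the
  premises of record (genuine-data arithmetic), or it does not exist. Instances of record (the B census words re-derived on this bed):
  RP-I05 `HInd3Hull` and RP-I05c `CandInternal11.H` hold at COSET (`UnitCoset.i05_at_cSetting` / `i05c_at_cSetting`, p450869) ⇒ neither is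
  `SufficientH` / `SufficientS` / `Sufficient` (`hInd3Hull_not_sufficientH`, `h11_not_sufficientH`, …).
* §2 **POSITIVE BED `UnitCosetShell.ksSetting p dStar`** (gen 6, p445248; the THRESHOLD coset bed where RP-I05 ∧ RP-I05c ∧ RP-I06 ∧ RP-I06⋆ ∧ Licence ∧
  GapH3 ∧ S_H ∧ Statement (=) hold and S fails): **`holds_at_ksStar_of_weaker_than_star`** — every candidate WEAKER THAN I06⋆ at that bed holds there,
  hence has a T-c witness at a positive containers bed (the (H5) entry of `plan/repair/bar/BARRIER-SCREEN.md`), and **`satPlus_notS_of_weaker_than_star`**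
  — it is jointly satisfiable with every premise of record, the containers reading and the Licence/Statement, AND with `¬S` for every q-pinned q-datum:
  ALONE INSUFFICIENT for S (abc-iut-w5-d068's SAT⁺ engine shape `UnitCosetShell.satPlusContainers_of_holds_at_ksSetting`, p445248, `p ≥ 7`).
One place (`toyIndex`, `l⋇ = 2`); models of the typed interface, not of initial Θ-data; no judgement on print or on any author.
[claim: Mochizuki2012, status: disputed] [cite: ScholzeStix2018, §2.2 pp. 9–10]
-/

noncomputable section

namespace Summit.ABC.IUTFork.Cor312Vol.UnitCoset

open Set Cor312 Cor312.Checks Cor312.IdentifiedNonVacuity NaiveWitness PinnedWitness PinnedHonest UnitWitness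
  Repair.CandInternal2 Literature.IUT.LogThetaLattice Repair
open Thm311 hiding toyIndex

variable {H : ∀ (T : ThetaIndex) (F : FullSituation T) (P : Setting F.toLatticeSituation.toSituation)
    (_ρ : (∀ v : T.V, v ∈ T.Vbad → Set (F.L.StarPacket v)) → ∀ (j : T.Label) (vQ : T.VQ), Set (F.L.Packet j vQ))
    (_qK : ∀ v : T.V, v ∈ T.Vbad → Set (F.L.StarPacket v)), Prop}

variable (p : ℕ) [hp : Fact p.Prime]

/-! ## 1. The negative bed: holding at `cSetting` refutes T-a at levels R, H and S -/

/-- **k2 SCREEN AT LEVEL H**: a candidate that HOLDS at the coset bed (all premises of record ✓, Licence ✗) is NOT `SufficientH`. [folklore] -/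
theorem not_sufficientH_of_holds_at_cSetting (h : H toyIndex (cFull p) (cSetting p) (cosetRegion p) (idealDatum p)) : ¬ SufficientH H :=
  fun hsuf => (cSetting_not_gapH3 p).1 (hsuf toyIndex (cFull p) (cSetting p) (cosetRegion p) (idealDatum p) (cFull_statement p)
    (c_multiradialCompat p) (cSetting_bridgeHyps p) (cSetting_absLogQPos p) (Repair.EvalRescueBeds.coset_thetaRegionsAdm p) (cSetting_pinnedRegions3 p) h)

/-- **k2 SCREEN AT LEVEL S**: a candidate that HOLDS at the coset bed (Statement ✗ there) is NOT `SufficientS`. [folklore] -/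
theorem not_sufficientS_of_holds_at_cSetting (h : H toyIndex (cFull p) (cSetting p) (cosetRegion p) (idealDatum p)) : ¬ SufficientS H :=
  fun hsuf => cSetting_not_statement p (hsuf toyIndex (cFull p) (cSetting p) (cosetRegion p) (idealDatum p) (cFull_statement p)
    (c_multiradialCompat p) (cSetting_bridgeHyps p) (cSetting_absLogQPos p) (Repair.EvalRescueBeds.coset_thetaRegionsAdm p) (cSetting_pinnedRegions3 p) h)

/-- **k2 SCREEN AT LEVEL R**: a candidate that HOLDS at the coset bed (S ✗ there) is NOT `Sufficient`. [folklore] -/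
theorem not_sufficient_of_holds_at_cSetting (h : H toyIndex (cFull p) (cSetting p) (cosetRegion p) (idealDatum p)) : ¬ Sufficient H :=
  fun hsuf => cSetting_not_pilotKummerIndRelated p (hsuf toyIndex (cFull p) (cSetting p) (cosetRegion p) (idealDatum p) (cFull_statement p)
    (c_multiradialCompat p) (cSetting_bridgeHyps p) (cSetting_absLogQPos p) (Repair.EvalRescueBeds.coset_thetaRegionsAdm p) (cSetting_pinnedRegions3 p) h)

/-- Instance of record: RP-I05 `HInd3Hull` (print's (Ind3)-as-containers clause) holds at the coset bed, hence is NOT `SufficientH` — alone it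
supplies no licence over the typed interface. [folklore] -/
theorem hInd3Hull_not_sufficientH :
    ¬ SufficientH (fun _ F P ρ _ => HInd3Hull F.toLatticeSituation P ρ) :=
  haveI : Fact (Nat.Prime 2) := ⟨Nat.prime_two⟩
  not_sufficientH_of_holds_at_cSetting 2 (i05_at_cSetting 2)

/-- … nor `SufficientS`. [folklore] -/
theorem hInd3Hull_not_sufficientS :
    ¬ SufficientS (fun _ F P ρ _ => HInd3Hull F.toLatticeSituation P ρ) :=
  haveI : Fact (Nat.Prime 2) := ⟨Nat.prime_two⟩
  not_sufficientS_of_holds_at_cSetting 2 (i05_at_cSetting 2)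

/-- Instance of record: RP-I05c `CandInternal11.H` (the (Ind3) container bound) holds at the coset bed, hence is NOT `SufficientH`. [folklore] -/
theorem h11_not_sufficientH :
    ¬ SufficientH (fun _ F P ρ _ => Repair.CandInternal11.H F.toLatticeSituation P ρ) :=
  haveI : Fact (Nat.Prime 2) := ⟨Nat.prime_two⟩
  not_sufficientH_of_holds_at_cSetting 2 (i05c_at_cSetting 2)

/-- … nor `SufficientS`. [folklore] -/
theorem h11_not_sufficientS :
    ¬ SufficientS (fun _ F P ρ _ => Repair.CandInternal11.H F.toLatticeSituation P ρ) :=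
  haveI : Fact (Nat.Prime 2) := ⟨Nat.prime_two⟩
  not_sufficientS_of_holds_at_cSetting 2 (i05c_at_cSetting 2)

/-- The JOINT print containers reading RP-I05 ∧ RP-I05c holds at the coset bed too, hence is NOT `SufficientH`: over the typed interface the two
Θ-side container clauses together still license nothing — the q-side clause RP-I06⋆ is the missing input (`UnitCoset.licence_of_star_at_cSetting`).
[folklore] -/
theorem hInd3Hull_and_h11_not_sufficientH :
    ¬ SufficientH (fun _ F P ρ _ => HInd3Hull F.toLatticeSituation P ρ ∧ Repair.CandInternal11.H F.toLatticeSituation P ρ) :=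
  haveI : Fact (Nat.Prime 2) := ⟨Nat.prime_two⟩
  not_sufficientH_of_holds_at_cSetting 2 ⟨i05_at_cSetting 2, i05c_at_cSetting 2⟩

/-! ## 2. The positive bed: candidates weaker than RP-I06⋆ have their T-c witness at `ksSetting p dStar` — and are alone insufficient for S -/

/-- **(H5) WITNESS**: a candidate implied by RP-I06⋆ at the threshold coset bed HOLDS there (RP-I06⋆ does: `UnitCosetShell.containers_dStar`). [folklore] -/
theorem holds_at_ksStar_of_weaker_than_star
    (hle : Repair.CandInternal11Gap.HQShellOrbitStar (UnitCosetShell.ksFull p UnitCosetShell.dStar).toLatticeSituation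
        (UnitCosetShell.ksSetting p UnitCosetShell.dStar) (cosetRegion p) (idealDatum p) →
      H toyIndex (UnitCosetShell.ksFull p UnitCosetShell.dStar) (UnitCosetShell.ksSetting p UnitCosetShell.dStar) (cosetRegion p) (idealDatum p)) :
    H toyIndex (UnitCosetShell.ksFull p UnitCosetShell.dStar) (UnitCosetShell.ksSetting p UnitCosetShell.dStar) (cosetRegion p) (idealDatum p) :=
  hle (UnitCosetShell.containers_dStar p).2.2.2

/-- **ALONE INSUFFICIENT FOR S**: a candidate weaker than RP-I06⋆ at the threshold coset bed (`p ≥ 7`) is jointly satisfiable with the typed Thm. 3.11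
(i)–(iii), `MultiradialCompat`, (ii)(b), the bridge hypotheses, `|log(q)| > 0`, the three pins, Step (x), exact `j²`, a genuinely MOVED Θ-region, an
infinite indeterminacy group, print's containers reading RP-I05 ∧ RP-I05c ∧ RP-I06, the Licence, S_H and the Statement — AND `¬S` for every q-pinned
q-datum (abc-iut-w5-d068's SAT⁺ shape, by `UnitCosetShell.satPlusContainers_of_holds_at_ksSetting`). [claim: Mochizuki2012, status: disputed] -/
theorem satPlus_notS_of_weaker_than_star (h7 : 7 ≤ p)
    (hle : Repair.CandInternal11Gap.HQShellOrbitStar (UnitCosetShell.ksFull p UnitCosetShell.dStar).toLatticeSituation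
        (UnitCosetShell.ksSetting p UnitCosetShell.dStar) (cosetRegion p) (idealDatum p) →
      H toyIndex (UnitCosetShell.ksFull p UnitCosetShell.dStar) (UnitCosetShell.ksSetting p UnitCosetShell.dStar) (cosetRegion p) (idealDatum p)) :
    ∃ (T : ThetaIndex) (F : FullSituation T) (P : Cor312.Setting F.toLatticeSituation.toSituation)
      (ρ : (∀ v : T.V, v ∈ T.Vbad → Set (F.L.StarPacket v)) → ∀ (j : T.Label) (vQ : T.VQ), Set (F.L.Packet j vQ))
      (qK : ∀ v : T.V, v ∈ T.Vbad → Set (F.L.StarPacket v)),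
      F.Statement ∧ F.MultiradialCompat ∧ (F.col P.n).KummerB (F.D P.n) ∧ BridgeHyps P ∧ P.AbsLogQPos ∧
        PinnedRegions3 F.toLatticeSituation P ρ qK ∧
        (∀ Φ ∈ F.L.Ind1Family ∪ F.L.Ind2Family, ∀ j vQ (B : Set (F.L.Packet j vQ)),
          (F.D P.n).Adm j vQ B ↔ (F.D P.n).Adm j vQ (Φ j vQ '' B)) ∧
        (F.D P.n).LogvolInvariant ∧
        (∀ (j : T.Label) (vQ : T.VQ), (F.D P.n).Adm j vQ (P.thetaRegion3 j vQ)) ∧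
        (∀ (i : Fin T.lstar) (vQ : T.VQ),
          (F.D P.n).logvol _ vQ (P.thetaRegion3 (Setting.labelSucc i) vQ) =
            (((i : ℕ) + 1 : ℕ) : ℝ) ^ 2 * P.qLocal (Setting.labelSucc i) vQ) ∧
        (∀ (i i' : Fin T.lstar) (vQ : T.VQ), P.qLocal (Setting.labelSucc i) vQ = P.qLocal (Setting.labelSucc i') vQ) ∧
        (∀ (i : Fin T.lstar) (vQ : T.VQ), P.qLocal (Setting.labelSucc i) vQ < 0) ∧
        H T F P ρ qK ∧
        PilotKummerCompatHull F.toLatticeSituation P ρ qK ∧ Thm311ToCor312.Licence P ∧ P.Statement ∧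
        (∃ (j : T.Label) (vQ : T.VQ), ∃ Φ ∈ Setting.indGroup F.toSituation,
          Φ j vQ '' P.thetaRegion3 j vQ ∈ P.possibleImages j vQ ∧ Φ j vQ '' P.thetaRegion3 j vQ ≠ P.thetaRegion3 j vQ) ∧
        (Setting.indGroup F.toSituation : Set F.L.PacketAut).Infinite ∧
        HInd3Hull F.toLatticeSituation P ρ ∧ Repair.CandInternal11.H F.toLatticeSituation P ρ ∧ HQShellOrbit F.toLatticeSituation P ρ qK ∧
        ¬ PilotKummerIndRelated F.toLatticeSituation P ρ qK ∧
        (∀ qK', QPinned F.toLatticeSituation P ρ qK' → ¬ PilotKummerIndRelated F.toLatticeSituation P ρ qK') :=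
  ⟨toyIndex, UnitCosetShell.ksFull p UnitCosetShell.dStar, UnitCosetShell.ksSetting p UnitCosetShell.dStar, cosetRegion p,
    idealDatum p, UnitCosetShell.ksFull_statement p _, UnitCosetShell.ks_multiradialCompat p _,
    UnitCosetShell.kColumn_kummerB_ksLine p _ _, UnitCosetShell.ksSetting_bridgeHyps p _, UnitCosetShell.ksSetting_absLogQPos p _,
    UnitCosetShell.ksSetting_pinnedRegions3 p _, UnitCosetShell.ksLine_hAdm p _ _, UnitCosetShell.ksLine_logvolInvariant p _ _,
    UnitCosetShell.ksSetting_thetaRegion3_adm p _, UnitCosetShell.ksSetting_scaled p _, UnitCosetShell.ksSetting_indep p _,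
    UnitCosetShell.ksSetting_qLocal_neg p _, holds_at_ksStar_of_weaker_than_star p hle,
    UnitCosetShell.ksSetting_pilotKummerCompatHull p _, UnitCosetShell.ksSetting_licence p _, UnitCosetShell.ksSetting_statement p _,
    ⟨1, (), UnitCosetShell.ksSetting_possibleImages_moved p _ h7 ()⟩, indClosure_infinite p,
    (UnitCosetShell.containers_dStar p).1, (UnitCosetShell.containers_dStar p).2.1, (UnitCosetShell.containers_dStar p).2.2.1,
    UnitCosetShell.ksSetting_not_pilotKummerIndRelated p _,
    fun qK' hq => UnitCosetShell.ksSetting_not_pilotKummerIndRelated_of_qPinned p _ qK' hq⟩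

end Summit.ABC.IUTFork.Cor312Vol.UnitCoset

end
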